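import Summits.BirchSwinnertonDyer.BirchSwinnertonDyer.Theorems.EisensteinPrimesGoodLatticeQuotCharUnramifiedAtP
import Summits.BirchSwinnertonDyer.BirchSwinnertonDyer.Theorems.EisensteinPrimesGoodLatticeAnacongEulerCompMultiplicative
import Literature.NumberTheory.EllipticCurves.LFunctionPrimeCoeff
import HarnessLib

/-!
# Kriz's Eisenstein-descent condition (1) AT `ℓ = p` for the quotient Teichmüller character at an ANOMALOUS prime:
# `θquot(Frob_p) = 1` and `a_p(E) ≡ φ̃(p) + φ̃(p)⁻¹·p (mod 𝔭)` — the last kernel input of the road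
# «3a-A ⟸ {CGLS's proof of Thm. 2.2.1, Hida's Thm. I} ∧ kernel»
# (cell `bsd-eis`, width seat `bsd-line-x1-p1-w2` gen 26; helper for crux 2 `GoodLatticeBDPValue`, `--supports stmt-BirchSwinnertonDyer-19032`)

WHY. `GoodLatticeAnacongOfCGLSProofOfDatum.anacongQ_of_proofThm221_of_thmI_of_datum` (this seat) derives [AN] from the named facts
`CastellaGrossiLeeSkinner2022.proofThm221_congruence_of_fullEisensteinDescent` and `Hida2010MuInvariant.thmI_mu_katzLFunction_eq_zero`,
the 3a-A datum, and ONE displayed hypothesis: Kriz Def. 31 (1) at `ℓ = p`, `‖a_p − (a + a⁻¹p)‖ < 1` for the Frobenius value `a` of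
`θquot` at the place of `p`. THIS FILE proves it under the hypotheses of 3a-A (`Anom`, the ramified rational line): at an anomalous
good ordinary `p` the reduction of every `p`-torsion point is fixed by a local Frobenius (`Ẽ[p] ⊆ Ẽ(𝔽_p)`, tree:
`X1.AnomalousReduction.localRed_frob_smul_eq_of_anomalous`), so `Frob_p·R − R` lies in `ker(red) ∩ E[p]`, which is the RAMIFIED
rational line `Φ` (as in `EisensteinPrimesMuLambda.smul_sub_mem_of_mem_inertia_of_not_lineUnramifiedAt`); hence `θquot(Frob_p) = 1`
(`apply_eq_one_of_forall_smul_sub_mem`), the Frobenius value is `a = 1`, and `a_p − (1 + p) ≡ a_p − 1 ≡ 0 (mod p)` by `Anom`.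

* §1 `frob_smul_sub_mem_of_anom` — `Frob·R − R ∈ Φ` on `E[p]` for the restriction of a local Frobenius at `p`.
* §2 `kriz_one_at_p_of_anom` — `‖a_p − (a + a⁻¹p)‖ < 1` for every `a` with `θquot.HasFrobCharpolyAt u (X − a)`, `u ∋ p`.

HONEST FRAMING: helper theorems (0 definitions, 0 named facts, 0 sorry); closes no stub; no summit statement / crux / BSD is proved
here. References: [GreenbergLNM1716] §3 Lemma 3.4 (p. 89); [Mazur1972] §5; [SilvermanAEC2009] VII.§2–3, Prop. VII.4.1;
[Kriz2016] Def. 31 (1), Thm. 35; [KellerYin2024] §1.4, Prop. 1.3.1 (`φ|_{G_p}`); [NeukirchANT1999] Ch. II (9.6).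
-/

set_option autoImplicit false
set_option linter.dupNamespace false

noncomputable section

open scoped Classical NNReal Pointwise

open NumberField IsDedekindDomain Field IsDedekindDomain.HeightOneSpectrum WeierstrassCurve
  Rat.HeightOneSpectrum
  Literature.NumberTheory.EllipticCurves Literature.NumberTheory.GaloisRepresentations
  Literature.NumberTheory.EllipticCurves.KellerYin2024 Literature.NumberTheory.EllipticCurves.Rank1Residual
  Summit.BirchSwinnertonDyer.Rank1Residual.X2.GreenbergVatsalReductionDatum
  Summit.BirchSwinnertonDyer.Rank1Residual.Additive
  Summit.BirchSwinnertonDyer.BirchSwinnertonDyer.Theorems.EisensteinPrimesMuLambda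

namespace Summit.BirchSwinnertonDyer.BirchSwinnertonDyer.Theorems.GoodLatticeKrizTraceConditionAtP

variable (W : WeierstrassCurve ℚ) [W.IsElliptic] [W.IsGloballyMinimal] (p : ℕ) [hp : Fact p.Prime]

/-! ## §1 A local Frobenius at an anomalous prime moves `E[p]` inside the ramified rational line -/

/-- **`Frob_p·R − R ∈ Φ` on `E[p]` at an anomalous prime.** For a globally minimal `E/ℚ` with good ORDINARY ANOMALOUS reduction at
`p` (`p ∤ a_p`, `p ∣ #Ẽ(𝔽_p)`), a rational `p`-line `Φ` RAMIFIED at `p`, a place `u ∋ p`, a prime `𝔐` of `\bar ℤ_u` with a local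
arithmetic Frobenius `τ ∈ Γ_{ℚ_u}`, and the standard embedding `ι : ℚ̄ → ℚ̄_u`: for every `R ∈ E[p](ℚ̄)`,
`(τ|_{ℚ̄})·R − R ∈ Φ`. (The reduction of `R` is fixed by `τ` — `Ẽ[p] ⊆ Ẽ(𝔽_p)` at an anomalous prime —, so `τR − R` lies in
`ker red ∩ E[p] = ⟨P₁⟩`, which is `Φ` read in `E(K̄_u)` because `Φ` is inertia-stable and ramified.)
[cite: GreenbergLNM1716, §3 Lemma 3.4 (p. 89) and §1 p. 62] [cite: SilvermanAEC2009, VII.§2–3, Prop. VII.4.1] [cite: Mazur1972, §5] -/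
theorem frob_smul_sub_mem_of_anom (hgood : W.HasGoodReductionAtPrime p) (hord : ¬ (p : ℤ) ∣ W.frobeniusTrace p)
    (hanom : p ∣ W.reductionPointCount p) {Φ : AddSubgroup (geomTorsion W (p : ℤ))}
    (hΦ : IsRationalLine W p Φ) (hram : ¬ LineUnramifiedAt W p Φ)
    {u : HeightOneSpectrum (𝓞 ℚ)} (hu : ((p : ℕ) : 𝓞 ℚ) ∈ u.asIdeal)
    {𝔐 : Ideal u.localAbsIntegers} (h𝔐 : 𝔐 ∈ u.localPrimesAbove)
    {τ : absoluteGaloisGroup (u.adicCompletion ℚ)} (hτ : IsArithFrobAt (u.adicCompletionIntegers ℚ) τ 𝔐)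
    {R : geomPoints W} (hR : R ∈ geomTorsion W (p : ℤ)) :
    resGalOfEmb (closureEmb (K := ℚ) (u.adicCompletion ℚ)) τ • R - R ∈ Φ.map (geomTorsion W (p : ℤ)).subtype := by
  -- adapted from `EisensteinPrimesMuLambda.smul_sub_mem_of_mem_inertia_of_not_lineUnramifiedAt` (inertia ↦ Frobenius)
  have hΔ : ¬ (p : ℤ) ∣ minimalDiscriminantInt W :=
    W.not_dvd_minimalDiscriminantInt_of_hasGoodReductionAtPrime' p hgood
  obtain ⟨-, hstab⟩ := hΦ
  set ι : AlgebraicClosure ℚ →ₐ[ℚ] AlgebraicClosure (u.adicCompletion ℚ) :=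
    closureEmb (K := ℚ) (u.adicCompletion ℚ) with hι
  -- §a the kernel line `⟨P₁⟩ = ker red ∩ E[p]`; inertia differences and the Frobenius difference land in it
  obtain ⟨P₁, -, hord₁, hmult⟩ := exists_generator_ker_localRed_torsion W p hu hΔ hord
  have keyI : ∀ {ρ : absoluteGaloisGroup ℚ}, ρ ∈ (u.primeBelow ι 𝔐).inertia (absoluteGaloisGroup ℚ) →
      ∀ {R : geomPoints W}, R ∈ geomTorsion W (p : ℤ) →
        ∃ c : ℕ, pointsMapOfEmb W ι (ρ • R - R) = c • P₁ := by
    intro ρ hρ R hR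
    obtain ⟨σ, hσI, hσ⟩ :=
      IsDedekindDomain.HeightOneSpectrum.exists_mem_inertia_apply_eq_holds u ι h𝔐 hρ
    have hres : resGalOfEmb ι σ = ρ := resGalOfEmb_eq_of_apply_eq ι hσ
    have hσabs : σ ∈ absInertia (u.adicCompletion ℚ) := by
      rw [← inertia_eq_absInertia (specVal_spec u) h𝔐]; exact hσI
    have hequiv : pointsMapOfEmb W ι (ρ • R) = σ • pointsMapOfEmb W ι R := by
      rw [← hres]
      exact pointsMapOfEmb_smul W ι σ R
    refine hmult _ ?_ ?_
    · rw [map_sub, hequiv, map_sub, localRed_smul_of_mem_absInertia W p hu hΔ hσabs, sub_self]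
    · rw [← map_zsmul, smul_sub, smul_comm, (mem_geomTorsion_iff W _ R).mp hR, smul_zero, sub_self,
        map_zero]
  have keyF : ∃ c : ℕ, pointsMapOfEmb W ι (resGalOfEmb ι τ • R - R) = c • P₁ := by
    have hequiv : pointsMapOfEmb W ι (resGalOfEmb ι τ • R) = τ • pointsMapOfEmb W ι R :=
      pointsMapOfEmb_smul W ι τ R
    have hpR : (p : ℤ) • pointsMapOfEmb W ι R = 0 := by
      rw [← map_zsmul, (mem_geomTorsion_iff W _ R).mp hR, map_zero]
    refine hmult _ ?_ ?_
    · rw [map_sub, hequiv, map_sub,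
        Summit.BirchSwinnertonDyer.Rank1Residual.X1.AnomalousReduction.localRed_frob_smul_eq_of_anomalous W p hu hΔ hord
          hanom h𝔐 hτ hpR, sub_self]
    · rw [← map_zsmul, smul_sub, smul_comm, (mem_geomTorsion_iff W _ R).mp hR, smul_zero, sub_self, map_zero]
  -- §b ramification of `Φ` at `𝔓' = 𝔓_{ι,𝔐}`: some `τ₀ ∈ I_{𝔓'}`, `P₀ ∈ Φ` with `τ₀P₀ ≠ P₀`
  have h𝔓' : u.primeBelow ι 𝔐 ∈ u.primesAbove := HeightOneSpectrum.primeBelow_mem_primesAbove h𝔐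
  obtain ⟨τ₀, hτ₀, P₀, hP₀Φ, hne⟩ : ∃ τ₀ ∈ (u.primeBelow ι 𝔐).inertia (absoluteGaloisGroup ℚ),
      ∃ P₀ ∈ Φ, τ₀ • P₀ ≠ P₀ := by
    simp only [LineUnramifiedAt, not_forall, exists_prop] at hram
    obtain ⟨v₀, hv₀, 𝔓₀, h𝔓₀, σ₀, hσ₀, P₀, hP₀, hne₀⟩ := hram
    have huv : v₀ = u := by
      rw [(natCast_mem_asIdeal_iff_eq_primesEquiv_symm v₀ hp.out).mp hv₀,
        (natCast_mem_asIdeal_iff_eq_primesEquiv_symm u hp.out).mp hu]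
    subst huv
    obtain ⟨g₀, hg₀⟩ := HeightOneSpectrum.exists_smul_eq_of_mem_primesAbove_holds h𝔓₀ h𝔓'
    refine ⟨g₀ * σ₀ * g₀⁻¹, ?_, g₀ • P₀, hstab g₀ P₀ hP₀, ?_⟩
    · rw [← hg₀]; exact (Ideal.conj_mem_inertia_smul_iff 𝔓₀ g₀ σ₀).mpr hσ₀
    · rw [mul_smul, mul_smul, inv_smul_smul]
      exact fun h ↦ hne₀ (MulAction.injective g₀ h)
  -- `D = τ₀P₀ − P₀ ∈ Φ ∖ 0`, read in `E(ℚ̄)`; `ι_* D = c₀ • P₁` with `c₀` a unit mod `p`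
  set D : geomPoints W := ((τ₀ • P₀ : geomTorsion W (p : ℤ)) : geomPoints W) - (P₀ : geomPoints W)
    with hDdef
  have hDmem : D ∈ Φ.map (geomTorsion W (p : ℤ)).subtype :=
    ⟨τ₀ • P₀ - P₀, Φ.sub_mem (hstab τ₀ P₀ hP₀Φ) hP₀Φ, by rw [map_sub]; rfl⟩
  have hD0 : D ≠ 0 := by
    intro h
    apply hne
    rw [hDdef, sub_eq_zero] at h
    exact Subtype.ext h
  have hDeq : D = τ₀ • (P₀ : geomPoints W) - (P₀ : geomPoints W) := by
    rw [hDdef, AddSubgroup.torsionBy.coe_smul]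
  obtain ⟨c₀, hc₀⟩ := keyI hτ₀ (R := (P₀ : geomPoints W)) P₀.2
  rw [← hDeq] at hc₀
  have hc₀0 : (c₀ : ZMod p) ≠ 0 := by
    intro h0
    apply hD0
    apply pointsMapOfEmb_injective W ι
    rw [map_zero, hc₀, nsmul_eq_nsmul_of_natCast_eq W p hord₁
      (show ((c₀ : ℕ) : ZMod p) = ((0 : ℕ) : ZMod p) by rw [h0, Nat.cast_zero]), zero_nsmul]
  -- §c the Frobenius difference is a multiple of `D`
  obtain ⟨c, hc⟩ := keyF
  set k : ℕ := ((c : ZMod p) * (c₀ : ZMod p)⁻¹).val with hk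
  have hkc : ((k * c₀ : ℕ) : ZMod p) = (c : ZMod p) := by
    rw [Nat.cast_mul, hk, ZMod.natCast_zmod_val, mul_assoc, inv_mul_cancel₀ hc₀0, mul_one]
  have heq : pointsMapOfEmb W ι (resGalOfEmb ι τ • R - R) = pointsMapOfEmb W ι (k • D) := by
    rw [hc, map_nsmul, hc₀, ← mul_smul, nsmul_eq_nsmul_of_natCast_eq W p hord₁ hkc]
  rw [pointsMapOfEmb_injective W ι heq]
  exact AddSubgroup.nsmul_mem _ hDmem k

/-! ## §2 Kriz (1) at `ℓ = p`: the Frobenius value of `θquot` at `p` is `1`, and `a_p ≡ 1 + p` -/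

variable {p} {S : Set (PadicAlgCl p)}

/-- **Kriz Def. 31 (1) at `ℓ = p` for the quotient Teichmüller character at an ANOMALOUS prime.** For `W/ℚ` globally minimal
elliptic with `Anom W p` (good reduction, `a_p ≡ 1 (mod p)`), every rational `p`-line ramified at `p`, a rational `p`-line `Φ` with a
Teichmüller lift `θquot` of the character on `E[p]/Φ`, a place `u ∋ p` and `a ∈ 𝒪` with `θquot.HasFrobCharpolyAt u (X − a)`:
`‖a_p(W) − (a + a⁻¹p)‖ < 1`, `a_p(W) = WeierstrassCurve.LFunction W p`. Indeed `a = θquot(τ|_{ℚ̄}) = 1` for a local Frobenius `τ`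
(§1 + `apply_eq_one_of_forall_smul_sub_mem`), and `a_p − (1 + p) ≡ a_p − 1 ≡ 0`. EXACTLY the hypothesis `hKa1p` of
`GoodLatticeAnacongOfCGLSProofOfDatum.anacongQ_of_proofThm221_of_thmI_of_datum`.
[cite: Kriz2016, Def. 31 (1), Thm. 35] [cite: KellerYin2024, Prop. 1.3.1 and §1.4 (arXiv:2402.12781v2 TeX L877, L1087)]
[cite: GreenbergLNM1716, §3 Lemma 3.4 (p. 89)] [cite: NeukirchANT1999, Ch. II §9 (9.6)] -/
theorem kriz_one_at_p_of_anom (hanom : Anom W p)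
    (hlat : ∀ Φ : AddSubgroup (geomTorsion W (p : ℤ)), IsRationalLine W p Φ → ¬ LineUnramifiedAt W p Φ)
    {Φ : AddSubgroup (geomTorsion W (p : ℤ))} (hΦ : IsRationalLine W p Φ)
    {θquot : FramedGaloisRep ℚ (padicCoeffIntegers S) 1}
    (hquot : IsTeichmullerLiftOnQuot S (Φ.map (geomTorsion W (p : ℤ)).subtype) (geomTorsion W (p : ℤ)) θquot)
    {u : HeightOneSpectrum (𝓞 ℚ)} (hu : ((p : ℕ) : 𝓞 ℚ) ∈ u.asIdeal)
    {a : padicCoeffIntegers S} (ha : θquot.HasFrobCharpolyAt u (Polynomial.X - Polynomial.C a)) :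
    ‖((W.LFunction p : ℤ) : PadicAlgCl p) - ((a : PadicAlgCl p) + (a : PadicAlgCl p)⁻¹ * (p : PadicAlgCl p))‖ < 1 := by
  have hpp := hp.out
  obtain ⟨-, hgood, hap⟩ := hanom
  have hord : ¬ (p : ℤ) ∣ W.frobeniusTrace p := by
    intro h
    have h1 : (p : ℤ) ∣ 1 := by
      have := Int.dvd_sub h hap
      rwa [sub_sub_cancel] at this
    exact hpp.one_lt.ne' (Int.natAbs_natCast p ▸ Int.eq_one_of_dvd_one (Int.natCast_nonneg p) h1 ▸ rfl)
  have hcount : p ∣ W.reductionPointCount p := by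
    have h' : (p : ℤ) ∣ (W.reductionPointCount p : ℤ) := by
      have e : (W.reductionPointCount p : ℤ) = (p : ℤ) - (W.frobeniusTrace p - 1) := by
        unfold WeierstrassCurve.frobeniusTrace; ring
      rw [e]
      exact dvd_sub (dvd_refl _) hap
    exact_mod_cast h'
  -- a local Frobenius at `p` and its restriction, a global Frobenius at `𝔓_{ι,𝔐}`
  obtain ⟨𝔐, h𝔐⟩ := u.localPrimesAbove_nonempty
  obtain ⟨τ, hτ⟩ := exists_isArithFrobAt_localAbsIntegers (v := u) h𝔐
  set ι : AlgebraicClosure ℚ →ₐ[ℚ] AlgebraicClosure (u.adicCompletion ℚ) :=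
    closureEmb (K := ℚ) (u.adicCompletion ℚ) with hι
  have h𝔓' : u.primeBelow ι 𝔐 ∈ u.primesAbove := HeightOneSpectrum.primeBelow_mem_primesAbove h𝔐
  have hφ₀ : IsArithFrobAt (𝓞 ℚ) (resGalOfEmb ι τ) (u.primeBelow ι 𝔐) := isArithFrobAt_resGalOfEmb (v := u) h𝔐 ι hτ
  -- `θquot(τ|) = 1`
  have hcardΦ : Nat.card (Φ.map (geomTorsion W (p : ℤ)).subtype) = p := by
    rw [Nat.card_congr (Φ.equivMapOfInjective (geomTorsion W (p : ℤ)).subtype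
      (geomTorsion W (p : ℤ)).subtype_injective).toEquiv.symm, hΦ.1]
  have hone : θquot (resGalOfEmb ι τ) = 1 :=
    apply_eq_one_of_forall_smul_sub_mem (WK := W) (K := ℚ) (S := S) hcardΦ hquot
      fun R hR ↦ frob_smul_sub_mem_of_anom W p hgood hord hcount hΦ (hlat Φ hΦ) hu h𝔐 hτ hR
  -- hence the Frobenius value is `a = 1`
  have ha1 : a = 1 := by
    have h := ha _ h𝔓' _ hφ₀
    rw [GoodLatticeAnacongEulerCompMultiplicative.charpoly_eq_X_sub_C_entry, sub_right_inj, Polynomial.C_inj] at h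
    rw [← h]
    unfold KellerYin2024.entry
    rw [hone, Units.val_one, Matrix.one_apply_eq]
  subst ha1
  -- `a_p − (1 + p) ≡ a_p − 1 ≡ 0 (mod p)`
  have haℓ : W.LFunction p = W.frobeniusTrace p := LFunction_apply_prime_eq_frobeniusTrace W p hgood
  push_cast
  rw [inv_one, one_mul, haℓ,
    show ((W.frobeniusTrace p : ℤ) : PadicAlgCl p) - (1 + (p : PadicAlgCl p)) =
      (((W.frobeniusTrace p - (1 + p) : ℤ) : ℚ_[p]) : PadicAlgCl p) by push_cast; rfl,
    PadicAlgCl.norm_extends, Padic.norm_intCast_lt_one_iff, sub_add_eq_sub_sub]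
  exact dvd_sub hap (dvd_refl _)

end Summit.BirchSwinnertonDyer.BirchSwinnertonDyer.Theorems.GoodLatticeKrizTraceConditionAtP

end
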